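import Summits.CriticalPhenomena.PercolationContinuityZ3.Theorems.PercNearOneGluingNoHeavyLowerTailFrontierDecRowsKeyCellDict
import Summits.CriticalPhenomena.PercolationContinuityZ3.Theorems.PercNearOneGluingNoHeavyLowerTailFrontierIncRowsPinnedEdge
import HarnessLib

/-!
# Rows for 52-cell KEY certificates: monotone pattern events, lifted rows, and the PATH induction hypotheses at every marking

Support file (prover seat `prim-facecert`, gen 5; `--supports stmt-CriticalPhenomena-4575`).  No named facts, no sorries, no `native_decide`;
bookkeeping definitions `pathPat₁/₂/₃` only (`lnkPat` is prim-l12-p6's, `…FrontierIncRowsPinnedEdge`).  Sequel of `…FrontierDecRowsKeyCellDict` (the valuation `cellVal`, `predExpr`, `harrisExpr`,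
`e3Expr`, `keyExpr`).

* `isLowerSet_pev_sepPat`, `isUpperSet_pev_lnkPat`, `isLowerSet/isUpperSet_pev_andPat` — monotonicity side conditions of Harris rows;
* `harrisExpr_lift_nonneg_of_lower/upper` — Harris under the CONTRACTED law `μ¹ = μ_{w[e↦1]}` is, in the cells of `μ⁰ = μ_{w[e↦0]}`, the Harris form of
  the lifted predicates (`real_one_pev_snoc`); `evalE_e3Expr_lift` — the same for Sahi cubics (rows of the law `μ¹`, in particular the induction
  hypothesis `E₃ ≥ 0` under `w[e↦1]`);
* `pathPat₁/₂/₃ σ`, `connEvent_row36_comp` — the PATH triple `(D[p₀|p₁], D[p₀|p₂], D[p₁|p₃])` at the marking `v ∘ σ` of four of the five points, as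
  pattern predicates read at `v`: with `TerminalEdgeInduction.KeyHypAtAll` (prim-l12-p6 gen 4) the rows `e3Expr (pathPatᵢ σ)` (and their lifts) are
  admissible induction hypotheses in a certificate for the KEY form of PATH — the prim-facecert gen-5 'IHX' family.
-/

noncomputable section

namespace Summit.CriticalPhenomena.PercolationContinuityZ3.Theorems

namespace TerminalEdgeInduction

open MeasureTheory Literature.Probability.Percolation Literature.Probability.LatticeModels
open EdgeInduction CovTransferCert E3GroupSepCert PatternCells FaceCertKernelN
open Lean.Grind.CommRing (Expr)
open scoped Classical BigOperators

variable {n : ℕ}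

/-! ### Monotonicity of pattern events; lifted rows; induction-hypothesis rows -/

/-- A group separation read on five points is a decreasing event. [folklore] -/
theorem isLowerSet_pev_sepPat (I J : List (Fin 5)) (v : Fin 5 → Fin n) : IsLowerSet (pev (sepPat I J) v) := by
  rw [pev_sepPat]; exact isLowerSet_connEvent_sep _ _

/-- A group connection read on five points is an increasing event. [folklore] -/
theorem isUpperSet_pev_lnkPat (I J : List (Fin 5)) (v : Fin 5 → Fin n) : IsUpperSet (pev (lnkPat I J) v) := by
  rw [pev_lnkPat]; exact isUpperSet_connEvent_lnk _ _

/-- Conjunctions of decreasing pattern events are decreasing. [folklore] -/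
theorem isLowerSet_pev_andPat {Φ Ψ : (Fin 5 → Fin 5 → Bool) → Bool} {v : Fin 5 → Fin n} (hΦ : IsLowerSet (pev Φ v))
    (hΨ : IsLowerSet (pev Ψ v)) : IsLowerSet (pev (andPat Φ Ψ) v) := by
  rw [pev_andPat]; exact hΦ.inter hΨ

/-- Conjunctions of increasing pattern events are increasing. [folklore] -/
theorem isUpperSet_pev_andPat {Φ Ψ : (Fin 5 → Fin 5 → Bool) → Bool} {v : Fin 5 → Fin n} (hΦ : IsUpperSet (pev Φ v))
    (hΨ : IsUpperSet (pev Ψ v)) : IsUpperSet (pev (andPat Φ Ψ) v) := by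
  rw [pev_andPat]; exact hΦ.inter hΨ

/-- Lifting commutes with conjunction (definitionally). [folklore] -/
theorem liftPat_andPat (t u : Fin 5) (Φ Ψ : (Fin 5 → Fin 5 → Bool) → Bool) :
    liftPat t u (andPat Φ Ψ) = andPat (liftPat t u Φ) (liftPat t u Ψ) := rfl

section Lift
variable (w : Sym2 (Fin n) → unitInterval) (x : Fin 4 → Fin n) (u : Fin n) (i₀ : Fin 4)

/-- **Lifted Harris row**: Harris under the contracted law `μ¹` for two decreasing events of the five points is, in the cells of `μ⁰`,
the Harris form of the LIFTED predicates. [this work] -/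
theorem harrisExpr_lift_nonneg_of_lower (Φ Ψ : (Fin 5 → Fin 5 → Bool) → Bool)
    (hΦ : IsLowerSet (pev Φ (Fin.snoc x u))) (hΨ : IsLowerSet (pev Ψ (Fin.snoc x u))) :
    0 ≤ evalE (cellVal (prodBernoulli (Function.update w s(x i₀, u) 0)) (Fin.snoc x u))
      (harrisExpr (liftPat (Fin.castSucc i₀) (Fin.last 4) Φ) (liftPat (Fin.castSucc i₀) (Fin.last 4) Ψ)) := by
  rw [evalE_harrisExpr, ← pev_andPat, ← liftPat_andPat, ← real_one_pev_snoc, ← real_one_pev_snoc, ← real_one_pev_snoc, pev_andPat]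
  have h := prodBernoulli_harris_lower (Function.update w s(x i₀, u) 1) hΦ hΨ MeasurableSet.of_discrete MeasurableSet.of_discrete
  linarith

/-- **Lifted Harris row, increasing events.** [this work] -/
theorem harrisExpr_lift_nonneg_of_upper (Φ Ψ : (Fin 5 → Fin 5 → Bool) → Bool)
    (hΦ : IsUpperSet (pev Φ (Fin.snoc x u))) (hΨ : IsUpperSet (pev Ψ (Fin.snoc x u))) :
    0 ≤ evalE (cellVal (prodBernoulli (Function.update w s(x i₀, u) 0)) (Fin.snoc x u))
      (harrisExpr (liftPat (Fin.castSucc i₀) (Fin.last 4) Φ) (liftPat (Fin.castSucc i₀) (Fin.last 4) Ψ)) := by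
  rw [evalE_harrisExpr, ← pev_andPat, ← liftPat_andPat, ← real_one_pev_snoc, ← real_one_pev_snoc, ← real_one_pev_snoc, pev_andPat]
  have h := prodBernoulli_harris (Function.update w s(x i₀, u) 1) hΦ hΨ MeasurableSet.of_discrete MeasurableSet.of_discrete
  linarith

/-- **Lifted Sahi cubic**: the `e3Expr` of lifted predicates evaluates to `sahiE3` under the contracted law `μ¹`. [this work] -/
theorem evalE_e3Expr_lift (Φ₁ Φ₂ Φ₃ : (Fin 5 → Fin 5 → Bool) → Bool) :
    evalE (cellVal (prodBernoulli (Function.update w s(x i₀, u) 0)) (Fin.snoc x u))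
        (e3Expr (liftPat (Fin.castSucc i₀) (Fin.last 4) Φ₁) (liftPat (Fin.castSucc i₀) (Fin.last 4) Φ₂) (liftPat (Fin.castSucc i₀) (Fin.last 4) Φ₃)) =
      sahiE3 (prodBernoulli (Function.update w s(x i₀, u) 1)) (pev Φ₁ (Fin.snoc x u)) (pev Φ₂ (Fin.snoc x u)) (pev Φ₃ (Fin.snoc x u)) := by
  rw [evalE_e3Expr, sahiE3_def, sahiE3_def]
  simp only [← pev_andPat, ← liftPat_andPat, ← real_one_pev_snoc]

end Lift

/-! ### The PATH row at every marking of the five points: induction-hypothesis rows (`KeyHypAtAll`) in the cells -/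

/-- The PATH triple `(D[p₀|p₁], D[p₀|p₂], D[p₁|p₃])` read at four of the five points. [this work] -/
def pathPat₁ (σ : Fin 4 → Fin 5) : (Fin 5 → Fin 5 → Bool) → Bool := sepPat [σ 0] [σ 1]
/-- Second PATH event at the marking `σ`. [this work] -/
def pathPat₂ (σ : Fin 4 → Fin 5) : (Fin 5 → Fin 5 → Bool) → Bool := sepPat [σ 0] [σ 2]
/-- Third PATH event at the marking `σ`. [this work] -/
def pathPat₃ (σ : Fin 4 → Fin 5) : (Fin 5 → Fin 5 → Bool) → Bool := sepPat [σ 1] [σ 3]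

/-- The PATH events at the marking `v ∘ σ` are the `pathPat` events read at `v`. [this work] -/
theorem connEvent_row36_comp (v : Fin 5 → Fin n) (σ : Fin 4 → Fin 5) :
    connEvent (FrontierDecRows.row 36 n ((v ∘ σ) 0, (v ∘ σ) 1, (v ∘ σ) 2, (v ∘ σ) 3)).1 = pev (pathPat₁ σ) v ∧
    connEvent (FrontierDecRows.row 36 n ((v ∘ σ) 0, (v ∘ σ) 1, (v ∘ σ) 2, (v ∘ σ) 3)).2.1 = pev (pathPat₂ σ) v ∧
    connEvent (FrontierDecRows.row 36 n ((v ∘ σ) 0, (v ∘ σ) 1, (v ∘ σ) 2, (v ∘ σ) 3)).2.2 = pev (pathPat₃ σ) v := by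
  refine ⟨?_, ?_, ?_⟩ <;> simp only [pathPat₁, pathPat₂, pathPat₃, pev_sepPat, List.map, Function.comp_apply] <;> rfl

end TerminalEdgeInduction

end Summit.CriticalPhenomena.PercolationContinuityZ3.Theorems
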